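/-
Copyright: public-audit package `pub-balaban` (b2b-balaban), seat pv16-g9. Released under Apache 2.0 like Mathlib.
-/
import Literature.MathematicalPhysics.QuantumFieldTheory.Balaban1983to89.T4FlatExteriorInvariance
import Literature.MathematicalPhysics.QuantumFieldTheory.Balaban1983to89.T4CoReadMoment

/-!
# T4TiltModulus — the GIBBS-TILT (density-ratio) modulus of the model conditional law `condLaw s old V` in the
# exterior `V`: an ANALYTICITY-FREE supplier of the hypothesis shapes `T4FirstOrderSize.MeanLipschitz` and
# `T4CoReadMoment.pairMean_norm_le_of_lipschitz (hL)` (cell `pub-balaban`, T4-DAG v9 §5; self-proposed kernel row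
# T4-O3.E-iii-b-G7-TILT* of the pv28 lineage (gen 6, HANDOFF «ADDENDUM 3», GAPS N-pv28g6-3), written by the pv16
# lineage (gen 9) as owner of `MeanLipschitz`; kernel bookkeeping, Mathlib + three cell modules BY NAME)

HONEST FRAMING (cell `pub-balaban`, T4-DAG PAGE 1).  The cell's T4 target is the existence AND uniqueness of the
continuum limit of Bałaban's unit-scale averaged loop expectations on a finite torus — a constructive-QFT statement
strictly beyond ultraviolet stability ([Balaban1989LargeFieldII] Thm 1 p. 355); it is NOT the Yang–Mills mass gap and
NOT the Clay problem.  This module is ELEMENTARY and asserts NOTHING about Bałaban's papers: no statement of the series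
B1–B16 is quoted, used or typed here, and no estimate of the series is proved.  It supplies, at KERNEL level, the
classical DENSITY-RATIO (Gibbs-tilt / Dobrushin-coefficient) modulus of continuity of a normalised law in its density,
and applies it BY NAME to pv04-g5's model `T4DressingDefect.condLaw s old V` of the conditional law `E_t[· | V_out]`
(the integrated density `old` against product Haar on the fibre of bond variables over `s`, exterior `V`).  OUTPUT: the
two Lipschitz-in-the-exterior hypothesis shapes of the (β) node and of row O3.E-iii-b-G7 — pv16's
`T4FirstOrderSize.MeanLipschitz dom m S u₀ dev lip` (l. 237) and the binder `hL` of pv28-g4's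
`T4CoReadMoment.pairMean_norm_le_of_lipschitz` — DISCHARGED from ONE explicit hypothesis on the fibre densities,
with NO analyticity, NO complexified background, NO `(R, M)` Schwarz species (cf. `T4CoReadAxialCondLaw` §4, G7-4) and
NO analytic-slice-on-a-tube input (cf. `T4MeanLipschitzBirth.meanLipschitz_birth`): an ALTERNATIVE supplier next to
those two, not a replacement of any proved statement.  Every declaration is `[folklore]`.  Value: kernel lemma +
bookkeeping of an implication ⇐ a named input; NOT summit progress.

## The mechanism (T1)–(T4) of the row proposal, as typed here

* (T1) §1, ABSTRACT, Mathlib only.  Two real densities `p₁, p₂ ≥ 0` on a measure space `(S, ν)` are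
  `RatioClose κ ε p₁ p₂` when `e^{κ−ε}·p₂ ≤ p₁ ≤ e^{κ+ε}·p₂` POINTWISE (a mutual Gibbs tilt up to the free constant
  `e^{κ}`; it forces `{p₁ = 0} = {p₂ = 0}` — the (S-TILT) caveat below is thereby a HYPOTHESIS, not hidden).  Then the
  normalising constants satisfy the same sandwich (`RatioClose.integral_bounds`), the normalised densities satisfy
  `|p₁/Z₁ − p₂/Z₂| ≤ (e^{2ε} − 1)·p₂/Z₂` (`div_ratio_bounds`, `abs_sub_le_of_ratio`; `2 ≤ e^{2ε} + e^{−2ε}` from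
  `Real.add_one_le_exp`), and for every Banach-space-valued insert `F` with `‖F − c‖ ≤ M` (any centre `c`):
  `‖∫F d(normLaw ν p₁) − ∫F d(normLaw ν p₂)‖ ≤ (e^{2ε} − 1)·M` (`norm_integral_normLaw_sub_le`; the centre drops out
  because both laws have mass one, `norm_integral_smul_sub_le`), with the linearisation
  `e^{2ε} − 1 ≤ 2e^{2ε₀}·ε` on `0 ≤ ε ≤ ε₀` (`exp_two_mul_sub_one_le`).  The Gibbs form `pᵢ = w·e^{hᵢ}`, `w ≥ 0`,
  `|h₁ − h₂ − κ| ≤ ε` is ratio-close (`ratioClose_of_exp`).  The scalar exponential-tilt case is Georgii's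
  Proposition 8.8, IN THE TREE as `Literature.Probability.LatticeModels.DobrushinMetric.
  abs_integral_tilted_sub_integral_tilted_le` (`DobrushinTiltOscillation.lean`); the present density-RATIO form (a
  window `w` with zeros is allowed, vector-valued inserts) is re-proved here from Mathlib alone, so that no import
  edge from `Probability/LatticeModels` enters the T4 cone.  An add-on books exterior-DEPENDENT inserts
  (`norm_integral_sub_integral_le_of_insert`: `+ sup‖F₁ − F₂‖`, caveat (B-INS)).
* (T2) §2, MODEL LINK, by `rfl`.  `condLaw s old V = normLaw (fibreBase s) (fibreDensity s old V)`
  (`condLaw_eq_normLaw`: pv04's `condLaw` IS the normalised law of the fibre density `y ↦ old(V←y)` against product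
  Haar `fibreBase s`), the
  fibre density is measurable / integrable / of total integral `fibreIntegral s old V` (`integral_fibreDensity_eq`,
  via `T4DressingDefect.toReal_fibreLaw_univ`), hence positive under the printed proviso `fibreIntegral s old V ≠ 0`
  («the denominators are positive», the hypothesis `hne` of pv04's `isProbabilityMeasure_condLaw`).
* (T3) §2, THE MODULUS.  `FibreRatioClose s old u u₀ κ ε` := the fibre densities at the exteriors `u`, `u₀` are
  ratio-close; then for every insert `F` on the fibre with `‖F − c‖ ≤ M`:
  `‖∫F ∂condLaw s old u − ∫F ∂condLaw s old u₀‖ ≤ (e^{2ε} − 1)·M` (`norm_integral_condLaw_sub_le`).  For a Gibbs-form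
  density `old = χ·e^{h}` whose window `χ ≥ 0` is EXTERIOR-BLIND on the fibre (`χ(u←y) = χ(u₀←y)`) and whose exponent
  increment oscillates by `≤ ε` about a constant `κ` on the fibre (`|h(u←y) − h(u₀←y) − κ| ≤ ε`) the hypothesis holds
  (`fibreRatioClose_of_exp`) — `κ` absorbs every term of `h` not touching the fibre, so only the terms meeting BOTH a
  fibre bond and a bond where `u ≠ u₀` contribute to `ε`.
* (T4) §3, DISCHARGE BY NAME.  On the domain `tiltDom s old u₀ κ ε ε₀ = {u | FibreRatioClose s old u u₀ (κ u) (ε u),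
  0 ≤ ε u ≤ ε₀}` (it contains `u₀` when `κ u₀ = ε u₀ = 0`, `self_mem_tiltDom`): `MeanLipschitz (tiltDom …)
  (u ↦ b ↦ ∫ B(·) b ∂condLaw s old u) S u₀ ε (2e^{2ε₀}M)` for bond inserts with `‖B(·) b − c b‖ ≤ M`
  (`meanLipschitz_of_tilt`; with `MeanVanishes` at `u₀`, `CondMeanSuppression`, `condMeanSuppression_of_tilt`, via
  pv16's `condMeanSuppression_of_flat`), and the pair twin for pv28-g4's `pairMeanField (condLaw s old u) B`
  (`pairMeanField_lipschitz_of_tilt` = the binder `hL` with `dev := ε`, `lip := 2e^{2ε₀}M`;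
  `pairMeanField_norm_le_of_tilt` via `pairMean_norm_le_of_lipschitz`).

## WHAT IS NOT PROVED / NOT PRINTED (record `t4/T4-EST-O3Ei1.md` v1.4 §4d; pv28's record `t4/T4-EST-O3Eiiib-G7.md`
§ «G7-T» is that lineage's to write)

* (S-TILT) That Bałaban's conditional densities at two exteriors ARE ratio-close on the fibre is a HYPOTHESIS
  (`FibreRatioClose`; `hχ` + `hh` of `fibreRatioClose_of_exp`); nothing printed is typed or asserted here.  LOCATED
  CONTEXT (v1.0.1; renders read as images by the pv16-g9 seat; record §4d; NOT a claim of this module): in the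
  quotient of [Balaban1989LargeFieldI] (1.100) p. 201 the fibre-restricting factors `δ_{G_i}(V′) χ(Λ_i)`, with
  «χ(Λ_i) = χ({|(1/i) log V′(b)| < M₀ε_k for b ∈ Λ_i})» (1.101), depend on the integration variable `V′⌈Λ_i` only,
  the exterior entering through the exponent `−(1/g_k²) A(ζ_i, U_{k,X_i}(V′ V_{Λ_i}))`; in [Balaban1987RG1] (2.10)
  p. 267 the factors `σ(B′) δ(Q̃(B′)) χ_k`, with «χ_k = Π_{b ∈ T^{(k)} ∖ {b₀(c) : c ∈ T^{(k+1)}} χ({|B′(b)| < ε₁})»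
  (2.9) p. 266, restrict the fluctuation variable `B′` only, and the `B′`-independent term `−(1/g_k²) A(U_{k+1})` of
  the exponent is what the free constant `κ` absorbs.  In BOTH places the fibre variable is the fluctuation RELATIVE
  to the exterior-dependent background (`V′ V_{Λ_i}`; «Ṽ′(y, x) = (V′V^{(k)})(y, x)(V^{(k)}(y, x))^{−1}» before (2.5)
  p. 266), the δ-function factors are not densities (DIVERGENCE F7 / D-f2.8 / D-pv16.2 standing), and after the
  Gaussian normalisation (2.12)–(2.13) p. 268 the reference measure `dμ_{C^{(k)}(U_{k+1})}` itself depends on the new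
  field — so whether, and in which coordinates, these printed laws instantiate `condLaw s old V` with an
  exterior-blind window is row O3.E-i′ (α)'s reading and the record's caveat, not decided here (DIVERGENCE D-pv16.5).
* (LOG) The ESTIMATE of the oscillation `ε(u)` by the deviation of `u` from `u₀` («`sup ε(u)/dev(u) < ∞` modulo the
  printed logarithms», GAPS G-pv28g6-1′) is NOT proved and not this module's: `ε` IS the deviation functional `dev` of
  the discharged shapes.  Consequently the constant `2e^{2ε₀}M` is honest only on a domain where `ε ≤ ε₀` is known.
* (B-INS) Inserts that themselves depend on the exterior are booked only with the additional sup-variation term of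
  `norm_integral_sub_integral_le_of_insert`, whose smallness is again an input.
* (SUP) The modulus is a SUP-line bound: first order in `ε`, but the constant is the oscillation bound `M` of the
  insert — NO variance / second-moment gain (cf. `T4CoReadMoment` §3: the variance line is a different booking).
* Conjugation invariance, axiality, `MeanVanishes` / zero pair mean at `u₀` are NOT touched: they remain the inputs of
  `T4FlatExteriorInvariance` / `T4CoReadAxial(CondLaw)` / `T4CoReadMoment` and enter §3 only as hypotheses by name.

Depends on `T4DressingDefect` (pv04-g5: `fibreLaw`, `condLaw`, `toReal_fibreLaw_univ`, `isProbabilityMeasure_condLaw`),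
`T4JointDressing` (`fibreIntegral_nonneg`), `B15BasicStep` (`fibreIntegral`, `haar_isProbabilityMeasure`),
`T4FirstOrderSize` (pv16: `MeanLipschitz`, `MeanVanishes`, `CondMeanSuppression`, `condMeanSuppression_of_flat`),
`T4CoReadMoment` (pv28-g4: `mcomm`, `pairMeanField`, `pairMean_norm_le_of_lipschitz`, `integrable_of_abs_le`) and
Mathlib (`integral_withDensity_eq_integral_toReal_smul`, `ofReal_integral_eq_lintegral_ofReal`,
`Integrable.smul_of_top_left`, `memLp_top_of_bound`, `norm_integral_le_of_norm_le_const`,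
`withDensity_absolutelyContinuous`, `Real.add_one_le_exp`, `Function.updateFinset`).  All declarations [folklore]; no
`[cite:]`.  Source declarations: 32 = 26 `theorem` + 5 `def` + 1 `abbrev` (35 gate records incl. 3 `eq_1`); v1.0.1 =
v1 p182681 (commit 379d95a95f32) + this DOCFIX (declaration census corrected, (S-TILT) located context); no
declaration changed.
-/

noncomputable section

open _root_.MeasureTheory
open Function (updateFinset)
open scoped ENNReal

namespace Literature.MathematicalPhysics.QuantumFieldTheory.Balaban1983to89.T4TiltModulus

open B15.BasicStep T4DressingDefect T4JointDressing T4FirstOrderSize T4CoReadMoment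

/-! ## §1 (T1)  Ratio-close densities and the tilt modulus of the normalised law (abstract, Mathlib only) -/

section Abstract

variable {S : Type*}

/-- RATIO-CLOSE real densities: `e^{κ−ε}·p₂ ≤ p₁ ≤ e^{κ+ε}·p₂` pointwise — `p₁` is a Gibbs tilt of `p₂` by a factor in
`[e^{κ−ε}, e^{κ+ε}]` (`κ` a free constant, `ε` the oscillation).  It forces equal zero sets: the (S-TILT) caveat is part
of the hypothesis. [folklore] -/
def RatioClose (κ ε : ℝ) (p₁ p₂ : S → ℝ) : Prop :=
  ∀ s, Real.exp (κ - ε) * p₂ s ≤ p₁ s ∧ p₁ s ≤ Real.exp (κ + ε) * p₂ s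

/-- Every density is ratio-close to itself with `κ = ε = 0` (non-vacuity of the domains of §3). [folklore] -/
theorem RatioClose.refl (p : S → ℝ) : RatioClose 0 0 p p := fun s => by simp

/-- Ratio-closeness is symmetric up to `κ ↦ −κ`. [folklore] -/
theorem RatioClose.symm {κ ε : ℝ} {p₁ p₂ : S → ℝ} (h : RatioClose κ ε p₁ p₂) : RatioClose (-κ) ε p₂ p₁ := by
  intro s
  obtain ⟨h₁, h₂⟩ := h s
  constructor
  · have h' := mul_le_mul_of_nonneg_left h₂ (Real.exp_pos (-κ - ε)).le
    rwa [← mul_assoc, ← Real.exp_add, show -κ - ε + (κ + ε) = 0 by ring, Real.exp_zero, one_mul] at h'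
  · have h' := mul_le_mul_of_nonneg_left h₁ (Real.exp_pos (-κ + ε)).le
    rwa [← mul_assoc, ← Real.exp_add, show -κ + ε + (κ - ε) = 0 by ring, Real.exp_zero, one_mul] at h'

/-- A density ratio-close to a non-negative one is non-negative. [folklore] -/
theorem RatioClose.nonneg {κ ε : ℝ} {p₁ p₂ : S → ℝ} (h : RatioClose κ ε p₁ p₂) (hp₂ : 0 ≤ p₂) : 0 ≤ p₁ :=
  fun s => (mul_nonneg (Real.exp_pos _).le (hp₂ s)).trans (h s).1

/-- THE GIBBS FORM: `pᵢ = w·e^{hᵢ}` with a common window `w ≥ 0` and `|h₁ − h₂ − κ| ≤ ε` pointwise is ratio-close.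
[folklore] -/
theorem ratioClose_of_exp {κ ε : ℝ} {w h₁ h₂ : S → ℝ} (hw : 0 ≤ w) (hh : ∀ s, |h₁ s - h₂ s - κ| ≤ ε) :
    RatioClose κ ε (fun s => w s * Real.exp (h₁ s)) (fun s => w s * Real.exp (h₂ s)) := by
  intro s
  obtain ⟨hl, hu⟩ := abs_le.mp (hh s)
  have e₁ : Real.exp (κ - ε) * Real.exp (h₂ s) ≤ Real.exp (h₁ s) := by
    rw [← Real.exp_add]; exact Real.exp_le_exp.mpr (by linarith)
  have e₂ : Real.exp (h₁ s) ≤ Real.exp (κ + ε) * Real.exp (h₂ s) := by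
    rw [← Real.exp_add]; exact Real.exp_le_exp.mpr (by linarith)
  constructor
  · calc Real.exp (κ - ε) * (w s * Real.exp (h₂ s)) = w s * (Real.exp (κ - ε) * Real.exp (h₂ s)) := by ring
      _ ≤ w s * Real.exp (h₁ s) := mul_le_mul_of_nonneg_left e₁ (hw s)
  · calc w s * Real.exp (h₁ s) ≤ w s * (Real.exp (κ + ε) * Real.exp (h₂ s)) := mul_le_mul_of_nonneg_left e₂ (hw s)
      _ = Real.exp (κ + ε) * (w s * Real.exp (h₂ s)) := by ring

/-- `cosh`-type comparison behind the one-sided constant: from `x ≤ e^{2ε}t` and `e^{−2ε}t ≤ x` (`t ≥ 0`),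
`|x − t| ≤ (e^{2ε} − 1)·t` — because `1 − e^{−2ε} ≤ e^{2ε} − 1` (`2 ≤ e^{2ε} + e^{−2ε}`, `Real.add_one_le_exp`).
[folklore] -/
theorem abs_sub_le_of_ratio {x t ε : ℝ} (ht : 0 ≤ t) (hup : x ≤ Real.exp (2 * ε) * t)
    (hlow : Real.exp (-(2 * ε)) * t ≤ x) : |x - t| ≤ (Real.exp (2 * ε) - 1) * t := by
  have hcosh : 2 * t ≤ Real.exp (2 * ε) * t + Real.exp (-(2 * ε)) * t := by
    rw [← add_mul]
    exact mul_le_mul_of_nonneg_right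
      (by linarith [Real.add_one_le_exp (2 * ε), Real.add_one_le_exp (-(2 * ε))]) ht
  rw [abs_sub_le_iff, show (Real.exp (2 * ε) - 1) * t = Real.exp (2 * ε) * t - t by ring]
  constructor <;> linarith

/-- NORMALISED RATIO BOUNDS: if `e^{κ−ε}b ≤ a ≤ e^{κ+ε}b` (`b ≥ 0`) and the normalisers obey the same sandwich
`e^{κ−ε}Z₂ ≤ Z₁ ≤ e^{κ+ε}Z₂` (`Z₂ > 0`), then `a/Z₁ ≤ e^{2ε}·(b/Z₂)` and `e^{−2ε}·(b/Z₂) ≤ a/Z₁` — the free constant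
`κ` cancels. [folklore] -/
theorem div_ratio_bounds {κ ε a b Z₁ Z₂ : ℝ} (hb : 0 ≤ b) (hZ₂ : 0 < Z₂) (hlo : Real.exp (κ - ε) * b ≤ a)
    (hhi : a ≤ Real.exp (κ + ε) * b) (hZlo : Real.exp (κ - ε) * Z₂ ≤ Z₁) (hZhi : Z₁ ≤ Real.exp (κ + ε) * Z₂) :
    a / Z₁ ≤ Real.exp (2 * ε) * (b / Z₂) ∧ Real.exp (-(2 * ε)) * (b / Z₂) ≤ a / Z₁ := by
  have hZ₁ : 0 < Z₁ := lt_of_lt_of_le (mul_pos (Real.exp_pos _) hZ₂) hZlo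
  have ht : 0 ≤ b / Z₂ := div_nonneg hb hZ₂.le
  have hexp : Real.exp (κ + ε) = Real.exp (2 * ε) * Real.exp (κ - ε) := by
    rw [← Real.exp_add]; congr 1; ring
  have hexp' : Real.exp (κ - ε) = Real.exp (-(2 * ε)) * Real.exp (κ + ε) := by
    rw [← Real.exp_add]; congr 1; ring
  constructor
  · rw [div_le_iff₀ hZ₁]
    calc a ≤ Real.exp (κ + ε) * b := hhi
      _ = Real.exp (2 * ε) * (b / Z₂) * (Real.exp (κ - ε) * Z₂) := by
          rw [hexp, mul_mul_mul_comm, div_mul_cancel₀ b hZ₂.ne', mul_assoc]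
      _ ≤ Real.exp (2 * ε) * (b / Z₂) * Z₁ :=
          mul_le_mul_of_nonneg_left hZlo (mul_nonneg (Real.exp_pos _).le ht)
  · rw [le_div_iff₀ hZ₁]
    calc Real.exp (-(2 * ε)) * (b / Z₂) * Z₁ ≤ Real.exp (-(2 * ε)) * (b / Z₂) * (Real.exp (κ + ε) * Z₂) :=
          mul_le_mul_of_nonneg_left hZhi (mul_nonneg (Real.exp_pos _).le ht)
      _ = Real.exp (κ - ε) * b := by
          rw [hexp', mul_mul_mul_comm, div_mul_cancel₀ b hZ₂.ne', mul_assoc]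
      _ ≤ a := hlo

/-- LINEARISATION of the constant: `e^{2ε} − 1 ≤ 2e^{2ε₀}·ε` for `0 ≤ ε ≤ ε₀` (`e^{x} − 1 ≤ x·e^{x}` from
`Real.add_one_le_exp (−x)`). [folklore] -/
theorem exp_two_mul_sub_one_le {ε ε₀ : ℝ} (h0 : 0 ≤ ε) (h1 : ε ≤ ε₀) :
    Real.exp (2 * ε) - 1 ≤ 2 * Real.exp (2 * ε₀) * ε := by
  have hE := Real.exp_pos (2 * ε)
  have hprod : Real.exp (2 * ε) * Real.exp (-(2 * ε)) = 1 := by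
    rw [← Real.exp_add, add_neg_cancel, Real.exp_zero]
  have h := mul_le_mul_of_nonneg_left (Real.add_one_le_exp (-(2 * ε))) hE.le
  rw [hprod] at h
  have h2 : Real.exp (2 * ε) - 1 ≤ 2 * ε * Real.exp (2 * ε) := by linarith
  have h3 : Real.exp (2 * ε) ≤ Real.exp (2 * ε₀) := Real.exp_le_exp.mpr (by linarith)
  calc Real.exp (2 * ε) - 1 ≤ 2 * ε * Real.exp (2 * ε) := h2
    _ ≤ 2 * ε * Real.exp (2 * ε₀) := mul_le_mul_of_nonneg_left h3 (by positivity)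
    _ = 2 * Real.exp (2 * ε₀) * ε := by ring

variable [MeasurableSpace S]

/-- THE CENTRED OSCILLATION STEP: for two integrable real weights `q₁, q₂` of integral one with
`|q₁ − q₂| ≤ δ·q₂` and a Banach-space-valued insert `F` with `‖F − c‖ ≤ M` pointwise,
`‖∫ q₁•F − ∫ q₂•F‖ ≤ δ·M` — the centre `c` drops out because `∫(q₁ − q₂) = 0`. [folklore] -/
theorem norm_integral_smul_sub_le (ν : Measure S) {E : Type*} [NormedAddCommGroup E] [NormedSpace ℝ E]
    [CompleteSpace E] {q₁ q₂ : S → ℝ} {F : S → E} {c : E} {δ M : ℝ} (hq₁ : Integrable q₁ ν)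
    (hq₂ : Integrable q₂ ν) (hq₁1 : ∫ s, q₁ s ∂ν = 1) (hq₂1 : ∫ s, q₂ s ∂ν = 1)
    (hq : ∀ s, |q₁ s - q₂ s| ≤ δ * q₂ s) (hF : AEStronglyMeasurable F ν) (hM : ∀ s, ‖F s - c‖ ≤ M) :
    ‖(∫ s, q₁ s • F s ∂ν) - ∫ s, q₂ s • F s ∂ν‖ ≤ δ * M := by
  have hbd : ∀ s, ‖F s‖ ≤ M + ‖c‖ := fun s =>
    calc ‖F s‖ = ‖(F s - c) + c‖ := by rw [sub_add_cancel]
      _ ≤ ‖F s - c‖ + ‖c‖ := norm_add_le _ _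
      _ ≤ M + ‖c‖ := by linarith [hM s]
  have hFtop : MemLp F ∞ ν := memLp_top_of_bound hF (M + ‖c‖) (ae_of_all _ hbd)
  have hFctop : MemLp (fun s => F s - c) ∞ ν :=
    memLp_top_of_bound (hF.sub aestronglyMeasurable_const) M (ae_of_all _ hM)
  have i₁ : Integrable (fun s => q₁ s • F s) ν := hq₁.smul_of_top_left hFtop
  have i₂ : Integrable (fun s => q₂ s • F s) ν := hq₂.smul_of_top_left hFtop
  have i₃ : Integrable (fun s => (q₁ s - q₂ s) • (F s - c)) ν := (hq₁.sub hq₂).smul_of_top_left hFctop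
  have i₄ : Integrable (fun s => (q₁ s - q₂ s) • c) ν := (hq₁.sub hq₂).smul_const c
  have hsplit : (∫ s, q₁ s • F s ∂ν) - ∫ s, q₂ s • F s ∂ν = ∫ s, (q₁ s - q₂ s) • (F s - c) ∂ν := by
    rw [← integral_sub i₁ i₂]
    have hpt : ∀ s, q₁ s • F s - q₂ s • F s = (q₁ s - q₂ s) • (F s - c) + (q₁ s - q₂ s) • c := fun s => by
      rw [smul_sub, sub_add_cancel, sub_smul]
    simp_rw [hpt]
    rw [integral_add i₃ i₄, integral_smul_const, integral_sub hq₁ hq₂, hq₁1, hq₂1, sub_self, zero_smul,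
      add_zero]
  rw [hsplit]
  calc ‖∫ s, (q₁ s - q₂ s) • (F s - c) ∂ν‖ ≤ ∫ s, ‖(q₁ s - q₂ s) • (F s - c)‖ ∂ν :=
        norm_integral_le_integral_norm _
    _ ≤ ∫ s, δ * q₂ s * M ∂ν := by
        refine integral_mono_of_nonneg (ae_of_all _ fun s => norm_nonneg _) ((hq₂.const_mul δ).mul_const M)
          (ae_of_all _ fun s => ?_)
        dsimp only
        rw [norm_smul, Real.norm_eq_abs]
        exact mul_le_mul (hq s) (hM s) (norm_nonneg _) ((abs_nonneg _).trans (hq s))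
    _ = δ * M := by rw [integral_mul_const, integral_const_mul, hq₂1, mul_one]

/-- THE NORMALISED LAW of a real density `p` against `ν`: `(∫p dν)⁻¹ · p dν` as a measure (`withDensity (ofReal ∘ p)`
scaled by the inverse of its total mass; the zero measure when the mass is `0` or `∞`).  pv04's `condLaw` is literally
of this form (`condLaw_eq_normLaw`). [folklore] -/
def normLaw (ν : Measure S) (p : S → ℝ) : Measure S :=
  ((ν.withDensity fun s => ENNReal.ofReal (p s)) Set.univ)⁻¹ • ν.withDensity fun s => ENNReal.ofReal (p s)

/-- Total mass of the weighted measure = `ofReal` of the Bochner integral of the (non-negative, integrable) density.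
[folklore] -/
theorem withDensity_ofReal_univ {ν : Measure S} {p : S → ℝ} (hp0 : 0 ≤ p) (hpi : Integrable p ν) :
    (ν.withDensity fun s => ENNReal.ofReal (p s)) Set.univ = ENNReal.ofReal (∫ s, p s ∂ν) := by
  rw [withDensity_apply _ MeasurableSet.univ, Measure.restrict_univ,
    ofReal_integral_eq_lintegral_ofReal hpi (ae_of_all _ hp0)]

/-- INTEGRATION AGAINST THE NORMALISED LAW: `∫F d(normLaw ν p) = ∫ (p/∫p)•F dν` (both sides `0` when `∫p = 0`).
[folklore] -/
theorem integral_normLaw {E : Type*} [NormedAddCommGroup E] [NormedSpace ℝ E] {ν : Measure S} {p : S → ℝ}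
    (hpm : Measurable p) (hp0 : 0 ≤ p) (hpi : Integrable p ν) (F : S → E) :
    ∫ s, F s ∂normLaw ν p = ∫ s, (p s / ∫ t, p t ∂ν) • F s ∂ν := by
  rw [normLaw, integral_smul_measure, withDensity_ofReal_univ hp0 hpi, ENNReal.toReal_inv,
    ENNReal.toReal_ofReal (integral_nonneg hp0),
    integral_withDensity_eq_integral_toReal_smul hpm.ennreal_ofReal
      (ae_of_all _ fun _ => ENNReal.ofReal_lt_top),
    ← integral_smul]
  refine integral_congr_ae (ae_of_all _ fun s => ?_)
  dsimp only
  rw [ENNReal.toReal_ofReal (hp0 s), smul_smul, div_eq_inv_mul]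

/-- **THE TILT MODULUS OF THE NORMALISED LAW (T1).**  For measurable integrable densities, `p₂ ≥ 0` of positive
integral, `RatioClose κ ε p₁ p₂`, and a Banach-space-valued insert `F` with `‖F − c‖ ≤ M` pointwise:
`‖∫F d(normLaw ν p₁) − ∫F d(normLaw ν p₂)‖ ≤ (e^{2ε} − 1)·M`.  The free constant `κ` does not enter the bound.
(Scalar exponential-tilt case: Georgii, Gibbs Measures and Phase Transitions, Prop. 8.8 — in the tree as
`DobrushinMetric.abs_integral_tilted_sub_integral_tilted_le`; not imported.) [folklore] -/
theorem norm_integral_normLaw_sub_le {E : Type*} [NormedAddCommGroup E] [NormedSpace ℝ E] [CompleteSpace E]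
    {ν : Measure S} {p₁ p₂ : S → ℝ} {κ ε M : ℝ} {F : S → E} {c : E} (hp₁m : Measurable p₁)
    (hp₂m : Measurable p₂) (hp₂0 : 0 ≤ p₂) (hp₁i : Integrable p₁ ν) (hp₂i : Integrable p₂ ν)
    (hZ₂ : 0 < ∫ s, p₂ s ∂ν) (hR : RatioClose κ ε p₁ p₂) (hF : AEStronglyMeasurable F ν)
    (hM : ∀ s, ‖F s - c‖ ≤ M) :
    ‖(∫ s, F s ∂normLaw ν p₁) - ∫ s, F s ∂normLaw ν p₂‖ ≤ (Real.exp (2 * ε) - 1) * M := by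
  have hp₁0 : 0 ≤ p₁ := hR.nonneg hp₂0
  have hZlo : Real.exp (κ - ε) * ∫ s, p₂ s ∂ν ≤ ∫ s, p₁ s ∂ν := by
    rw [← integral_const_mul]; exact integral_mono (hp₂i.const_mul _) hp₁i fun s => (hR s).1
  have hZhi : ∫ s, p₁ s ∂ν ≤ Real.exp (κ + ε) * ∫ s, p₂ s ∂ν := by
    rw [← integral_const_mul]; exact integral_mono hp₁i (hp₂i.const_mul _) fun s => (hR s).2
  have hZ₁ : 0 < ∫ s, p₁ s ∂ν := lt_of_lt_of_le (mul_pos (Real.exp_pos _) hZ₂) hZlo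
  rw [integral_normLaw hp₁m hp₁0 hp₁i, integral_normLaw hp₂m hp₂0 hp₂i]
  refine norm_integral_smul_sub_le ν (hp₁i.div_const _) (hp₂i.div_const _) ?_ ?_ (fun s => ?_) hF hM
  · rw [integral_div, div_self hZ₁.ne']
  · rw [integral_div, div_self hZ₂.ne']
  · obtain ⟨hup, hlow⟩ := div_ratio_bounds (hp₂0 s) hZ₂ (hR s).1 (hR s).2 hZlo hZhi
    exact abs_sub_le_of_ratio (div_nonneg (hp₂0 s) hZ₂.le) hup hlow

/-- The sandwich of the normalising constants, recorded: `e^{κ−ε}∫p₂ ≤ ∫p₁ ≤ e^{κ+ε}∫p₂`. [folklore] -/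
theorem RatioClose.integral_bounds {ν : Measure S} {κ ε : ℝ} {p₁ p₂ : S → ℝ} (h : RatioClose κ ε p₁ p₂)
    (hp₁ : Integrable p₁ ν) (hp₂ : Integrable p₂ ν) :
    Real.exp (κ - ε) * ∫ s, p₂ s ∂ν ≤ ∫ s, p₁ s ∂ν ∧ ∫ s, p₁ s ∂ν ≤ Real.exp (κ + ε) * ∫ s, p₂ s ∂ν := by
  constructor
  · rw [← integral_const_mul]; exact integral_mono (hp₂.const_mul _) hp₁ fun s => (h s).1
  · rw [← integral_const_mul]; exact integral_mono hp₁ (hp₂.const_mul _) fun s => (h s).2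

/-- (B-INS) ADD-ON FOR EXTERIOR-DEPENDENT INSERTS: if the insert changes too (`F₁` under `P₁` versus `F₂` under the
probability law `P₂`, `‖F₁ − F₂‖ ≤ D` pointwise), the difference of the means is bounded by the modulus for `F₁` plus
`D`. [folklore] -/
theorem norm_integral_sub_integral_le_of_insert {Ω : Type*} [MeasurableSpace Ω] {E : Type*} [NormedAddCommGroup E]
    [NormedSpace ℝ E] {P₁ P₂ : Measure Ω} [IsProbabilityMeasure P₂] {F₁ F₂ : Ω → E} {A D : ℝ}
    (h : ‖(∫ ω, F₁ ω ∂P₁) - ∫ ω, F₁ ω ∂P₂‖ ≤ A) (hi₁ : Integrable F₁ P₂) (hi₂ : Integrable F₂ P₂)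
    (hD : ∀ ω, ‖F₁ ω - F₂ ω‖ ≤ D) : ‖(∫ ω, F₁ ω ∂P₁) - ∫ ω, F₂ ω ∂P₂‖ ≤ A + D := by
  have hsplit : (∫ ω, F₁ ω ∂P₁) - ∫ ω, F₂ ω ∂P₂
      = ((∫ ω, F₁ ω ∂P₁) - ∫ ω, F₁ ω ∂P₂) + ∫ ω, (F₁ ω - F₂ ω) ∂P₂ := by
    rw [integral_sub hi₁ hi₂]; abel
  rw [hsplit]
  refine (norm_add_le _ _).trans (add_le_add h ?_)
  calc ‖∫ ω, (F₁ ω - F₂ ω) ∂P₂‖ ≤ D * P₂.real Set.univ := norm_integral_le_of_norm_le_const (ae_of_all _ hD)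
    _ = D := by rw [probReal_univ, mul_one]

end Abstract

/-! ## §2 (T2)/(T3)  The model link `condLaw = normLaw` and the tilt modulus of the conditional law in the exterior -/

section Fibre

variable {P : Params} {j : ℕ} {G : Type*} [GaugeGroup G] [MeasurableSpace G] [HaarData G]
variable [DecidableEq (PBond P j)]

/-- The BASE LAW of the fibre through `s`: the product of the normalised Haar measures over the bond variables `b ∈ s`
(a probability measure; pv04's `fibreLaw s old V` is its weighting by `old(V←·)`). [folklore] -/
abbrev fibreBase (s : Finset (PBond P j)) : Measure (s → G) := Measure.pi fun _ : s => (HaarData.haar : Measure G)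

omit [GaugeGroup G] [MeasurableSpace G] [HaarData G] in
/-- The FIBRE DENSITY at the exterior `u`: `y ↦ old(u←y)` (`u←y := updateFinset u s y`). [folklore] -/
def fibreDensity (s : Finset (PBond P j)) (old : Density P j G) (u : GaugeField P j G) : (s → G) → ℝ :=
  fun y => old (updateFinset u s y)

omit [GaugeGroup G] [MeasurableSpace G] [HaarData G] in
/-- HYPOTHESIS SHAPE (S-TILT + oscillation): the fibre densities at the exteriors `u` and `u₀` are RATIO-CLOSE with free
constant `κ` and oscillation `ε` — `e^{κ−ε}·old(u₀←y) ≤ old(u←y) ≤ e^{κ+ε}·old(u₀←y)` for every fibre configuration `y`.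
NOT PROVED for Bałaban's densities (record caveats (S-TILT), (LOG)). [folklore] -/
def FibreRatioClose (s : Finset (PBond P j)) (old : Density P j G) (u u₀ : GaugeField P j G) (κ ε : ℝ) : Prop :=
  RatioClose κ ε (fibreDensity s old u) (fibreDensity s old u₀)

/-- (T2) THE MODEL LINK, by `rfl`: pv04's conditional law IS the normalised law of the fibre density against the base
law. [folklore] -/
theorem condLaw_eq_normLaw (s : Finset (PBond P j)) (old : Density P j G) (V : GaugeField P j G) :
    condLaw s old V = normLaw (fibreBase s) (fibreDensity s old V) := rfl

omit [GaugeGroup G] [HaarData G] in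
/-- The fibre density of a measurable density is measurable. [folklore] -/
theorem measurable_fibreDensity (s : Finset (PBond P j)) {old : Density P j G} (hm : Measurable old)
    (V : GaugeField P j G) : Measurable (fibreDensity s old V) :=
  hm.comp measurable_updateFinset

/-- … and, if `0 ≤ old ≤ C`, integrable against the (probability) base law. [folklore] -/
theorem integrable_fibreDensity (s : Finset (PBond P j)) {old : Density P j G} (hm : Measurable old)
    (h0 : ∀ U, 0 ≤ old U) {C : ℝ} (hC : ∀ U, old U ≤ C) (V : GaugeField P j G) :
    Integrable (fibreDensity s old V) (fibreBase s) :=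
  integrable_of_abs_le (measurable_fibreDensity s hm V).aestronglyMeasurable (C := C) fun y => by
    rw [fibreDensity, abs_of_nonneg (h0 _)]; exact hC _

/-- Its integral against the base law is the tree's restricted integral `∫dV⌈_s old (V)` (`fibreIntegral`).
[folklore] -/
theorem integral_fibreDensity_eq (s : Finset (PBond P j)) {old : Density P j G} (hm : Measurable old)
    (h0 : ∀ U, 0 ≤ old U) {C : ℝ} (hC : ∀ U, old U ≤ C) (V : GaugeField P j G) :
    ∫ y, fibreDensity s old V y ∂fibreBase s = fibreIntegral s old V := by
  rw [← toReal_fibreLaw_univ,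
    show fibreLaw s old V = (fibreBase s).withDensity (fun y => ENNReal.ofReal (fibreDensity s old V y)) from rfl,
    withDensity_ofReal_univ (p := fibreDensity s old V) (fun y => h0 _) (integrable_fibreDensity s hm h0 hC V),
    ENNReal.toReal_ofReal (integral_nonneg (f := fibreDensity s old V) fun y => h0 _)]

/-- Under the printed proviso `fibreIntegral s old V ≠ 0` the fibre density has POSITIVE integral. [folklore] -/
theorem integral_fibreDensity_pos (s : Finset (PBond P j)) {old : Density P j G} (hm : Measurable old)
    (h0 : ∀ U, 0 ≤ old U) {C : ℝ} (hC : ∀ U, old U ≤ C) {V : GaugeField P j G} (hne : fibreIntegral s old V ≠ 0) :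
    0 < ∫ y, fibreDensity s old V y ∂fibreBase s := by
  rw [integral_fibreDensity_eq s hm h0 hC V]
  exact lt_of_le_of_ne (fibreIntegral_nonneg s old V) hne.symm

/-- **(T3) THE TILT MODULUS OF THE CONDITIONAL LAW IN THE EXTERIOR.**  For a measurable integrated density
`0 ≤ old ≤ C`, the printed proviso at the reference exterior `u₀`, ratio-close fibre densities
`FibreRatioClose s old u u₀ κ ε`, and an insert `F` on the fibre with `‖F − c‖ ≤ M`:
`‖∫F ∂condLaw s old u − ∫F ∂condLaw s old u₀‖ ≤ (e^{2ε} − 1)·M`.  No analyticity, no complexification; the input is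
the one quantity `ε`. [folklore] -/
theorem norm_integral_condLaw_sub_le {E : Type*} [NormedAddCommGroup E] [NormedSpace ℝ E] [CompleteSpace E]
    (s : Finset (PBond P j)) {old : Density P j G} (hm : Measurable old) (h0 : ∀ U, 0 ≤ old U) {C : ℝ}
    (hC : ∀ U, old U ≤ C) {u u₀ : GaugeField P j G} (hne : fibreIntegral s old u₀ ≠ 0) {κ ε : ℝ}
    (hR : FibreRatioClose s old u u₀ κ ε) {F : (s → G) → E} (hF : AEStronglyMeasurable F (fibreBase s)) {c : E}
    {M : ℝ} (hM : ∀ y, ‖F y - c‖ ≤ M) :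
    ‖(∫ y, F y ∂condLaw s old u) - ∫ y, F y ∂condLaw s old u₀‖ ≤ (Real.exp (2 * ε) - 1) * M := by
  rw [condLaw_eq_normLaw, condLaw_eq_normLaw]
  exact norm_integral_normLaw_sub_le (measurable_fibreDensity s hm u) (measurable_fibreDensity s hm u₀)
    (fun y => h0 _) (integrable_fibreDensity s hm h0 hC u) (integrable_fibreDensity s hm h0 hC u₀)
    (integral_fibreDensity_pos s hm h0 hC hne) hR hF hM

/-- (T3) WITH AN EXTERIOR-DEPENDENT INSERT (caveat (B-INS)): `‖∫F_u ∂condLaw u − ∫F_{u₀} ∂condLaw u₀‖ ≤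
(e^{2ε} − 1)·M + sup‖F_u − F_{u₀}‖` for measurable inserts bounded on the fibre. [folklore] -/
theorem norm_integral_condLaw_sub_le_of_insert {E : Type*} [NormedAddCommGroup E] [NormedSpace ℝ E]
    [CompleteSpace E] (s : Finset (PBond P j)) {old : Density P j G} (hm : Measurable old) (h0 : ∀ U, 0 ≤ old U)
    {C : ℝ} (hC : ∀ U, old U ≤ C) {u u₀ : GaugeField P j G} (hne : fibreIntegral s old u₀ ≠ 0) {κ ε : ℝ}
    (hR : FibreRatioClose s old u u₀ κ ε) {F F₀ : (s → G) → E} (hF : AEStronglyMeasurable F (fibreBase s))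
    (hF₀ : AEStronglyMeasurable F₀ (fibreBase s)) {c : E} {M M₀ D : ℝ} (hM : ∀ y, ‖F y - c‖ ≤ M)
    (hM₀ : ∀ y, ‖F₀ y‖ ≤ M₀) (hD : ∀ y, ‖F y - F₀ y‖ ≤ D) :
    ‖(∫ y, F y ∂condLaw s old u) - ∫ y, F₀ y ∂condLaw s old u₀‖ ≤ (Real.exp (2 * ε) - 1) * M + D := by
  haveI := isProbabilityMeasure_condLaw s hC u₀ hne
  have hbd : ∀ y, ‖F y‖ ≤ M + ‖c‖ := fun y =>
    calc ‖F y‖ = ‖(F y - c) + c‖ := by rw [sub_add_cancel]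
      _ ≤ ‖F y - c‖ + ‖c‖ := norm_add_le _ _
      _ ≤ M + ‖c‖ := by linarith [hM y]
  have hac : condLaw s old u₀ ≪ fibreBase s := by
    rw [condLaw_eq_normLaw, normLaw]
    exact (withDensity_absolutelyContinuous _ _).smul_left _
  refine norm_integral_sub_integral_le_of_insert (norm_integral_condLaw_sub_le s hm h0 hC hne hR hF hM) ?_ ?_ hD
  · exact (memLp_top_of_bound (hF.mono_ac hac) (M + ‖c‖) (ae_of_all _ hbd)).integrable le_top
  · exact (memLp_top_of_bound (hF₀.mono_ac hac) M₀ (ae_of_all _ hM₀)).integrable le_top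

omit [GaugeGroup G] [MeasurableSpace G] [HaarData G] in
/-- (T3) THE GIBBS-FORM SUPPLIER of the hypothesis: for `old = χ·e^{h}` with a window `χ ≥ 0` that is EXTERIOR-BLIND on
the fibre (`χ(u←y) = χ(u₀←y)`) and an exponent increment oscillating by `≤ ε` about a constant `κ` on the fibre
(`|h(u←y) − h(u₀←y) − κ| ≤ ε`), the fibre densities are ratio-close.  Both hypotheses are INPUTS ((S-TILT), (LOG)).
[folklore] -/
theorem fibreRatioClose_of_exp (s : Finset (PBond P j)) {χ h : Density P j G} (hχ0 : ∀ U, 0 ≤ χ U)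
    {u u₀ : GaugeField P j G} {κ ε : ℝ} (hχ : ∀ y : s → G, χ (updateFinset u s y) = χ (updateFinset u₀ s y))
    (hh : ∀ y : s → G, |h (updateFinset u s y) - h (updateFinset u₀ s y) - κ| ≤ ε) :
    FibreRatioClose s (fun U => χ U * Real.exp (h U)) u u₀ κ ε := by
  intro y
  simp only [fibreDensity]
  rw [hχ y]
  exact ratioClose_of_exp (w := fun y => χ (updateFinset u₀ s y)) (h₁ := fun y => h (updateFinset u s y))
    (h₂ := fun y => h (updateFinset u₀ s y)) (fun y => hχ0 _) hh y

/-! ## §3 (T4)  Discharge BY NAME of `MeanLipschitz` / `CondMeanSuppression` and of the pair-mean Lipschitz binder -/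

omit [GaugeGroup G] [MeasurableSpace G] [HaarData G] in
/-- THE TILT DOMAIN of exteriors: ratio-close to the reference `u₀` with free constant `κ u` and oscillation `ε u`,
`0 ≤ ε u ≤ ε₀`.  On it the oscillation functional `ε` IS the deviation `dev` of the discharged shapes — its estimate by
a distance of `u` from `u₀` is NOT this module's (caveat (LOG)). [folklore] -/
def tiltDom (s : Finset (PBond P j)) (old : Density P j G) (u₀ : GaugeField P j G) (κ ε : GaugeField P j G → ℝ)
    (ε₀ : ℝ) : Set (GaugeField P j G) :=
  {u | FibreRatioClose s old u u₀ (κ u) (ε u) ∧ 0 ≤ ε u ∧ ε u ≤ ε₀}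

omit [GaugeGroup G] [MeasurableSpace G] [HaarData G] in
/-- Non-vacuity: the reference exterior lies in its own tilt domain (`κ u₀ = ε u₀ = 0 ≤ ε₀`). [folklore] -/
theorem self_mem_tiltDom (s : Finset (PBond P j)) (old : Density P j G) (u₀ : GaugeField P j G)
    {κ ε : GaugeField P j G → ℝ} {ε₀ : ℝ} (hκ : κ u₀ = 0) (hε : ε u₀ = 0) (hε₀ : 0 ≤ ε₀) :
    u₀ ∈ tiltDom s old u₀ κ ε ε₀ := by
  rw [tiltDom, Set.mem_setOf_eq, hκ, hε]
  exact ⟨RatioClose.refl _, le_rfl, hε₀⟩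

/-- **(T4) `MeanLipschitz` FROM THE TILT MODULUS.**  For a measurable integrated density `0 ≤ old ≤ C` with the printed
proviso at `u₀`, and bond inserts `y ↦ B y b` (`b ∈ S`) a.e.-strongly measurable on the fibre with `‖B y b − c b‖ ≤ M`:
the exterior-indexed conditional mean field `u ↦ b ↦ ∫ B(·) b ∂condLaw s old u` satisfies pv16's
`T4FirstOrderSize.MeanLipschitz` on `tiltDom s old u₀ κ ε ε₀` with `dev := ε` and `lip := 2e^{2ε₀}M`.  (For an inner
product space `E` the mean field is `T4FirstOrderSize.meanField (condLaw s old u) B` by `rfl`.) [folklore] -/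
theorem meanLipschitz_of_tilt {E : Type*} [NormedAddCommGroup E] [NormedSpace ℝ E] [CompleteSpace E] {β : Type*}
    (s : Finset (PBond P j)) {old : Density P j G} (hm : Measurable old) (h0 : ∀ U, 0 ≤ old U) {C : ℝ}
    (hC : ∀ U, old U ≤ C) {u₀ : GaugeField P j G} (hne : fibreIntegral s old u₀ ≠ 0)
    {κ ε : GaugeField P j G → ℝ} {ε₀ : ℝ} {B : (s → G) → β → E} {S : Finset β}
    (hB : ∀ b ∈ S, AEStronglyMeasurable (fun y => B y b) (fibreBase s)) {c : β → E} {M : ℝ}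
    (hM : ∀ b ∈ S, ∀ y, ‖B y b - c b‖ ≤ M) :
    MeanLipschitz (tiltDom s old u₀ κ ε ε₀) (fun u b => ∫ y, B y b ∂condLaw s old u) S u₀ ε
      (2 * Real.exp (2 * ε₀) * M) := by
  intro u hu b hb
  obtain ⟨hR, hε0, hε1⟩ := hu
  have hMnn : 0 ≤ M := (norm_nonneg _).trans (hM b hb (fun _ => 1))
  calc ‖(∫ y, B y b ∂condLaw s old u) - ∫ y, B y b ∂condLaw s old u₀‖ ≤ (Real.exp (2 * ε u) - 1) * M :=
        norm_integral_condLaw_sub_le s hm h0 hC hne hR (hB b hb) (hM b hb)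
    _ ≤ 2 * Real.exp (2 * ε₀) * ε u * M := mul_le_mul_of_nonneg_right (exp_two_mul_sub_one_le hε0 hε1) hMnn
    _ = 2 * Real.exp (2 * ε₀) * M * ε u := by ring

/-- (T4) … hence, with `MeanVanishes` at the reference exterior (row O3.E-i′ (α)/K: conjugation invariance + Ad, NOT
touched here), pv16's `CondMeanSuppression` on the tilt domain — by `condMeanSuppression_of_flat`. [folklore] -/
theorem condMeanSuppression_of_tilt {E : Type*} [NormedAddCommGroup E] [NormedSpace ℝ E] [CompleteSpace E]
    {β : Type*} (s : Finset (PBond P j)) {old : Density P j G} (hm : Measurable old) (h0 : ∀ U, 0 ≤ old U) {C : ℝ}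
    (hC : ∀ U, old U ≤ C) {u₀ : GaugeField P j G} (hne : fibreIntegral s old u₀ ≠ 0)
    {κ ε : GaugeField P j G → ℝ} {ε₀ : ℝ} {B : (s → G) → β → E} {S : Finset β}
    (hB : ∀ b ∈ S, AEStronglyMeasurable (fun y => B y b) (fibreBase s)) {c : β → E} {M : ℝ}
    (hM : ∀ b ∈ S, ∀ y, ‖B y b - c b‖ ≤ M) (hflat : MeanVanishes S fun b => ∫ y, B y b ∂condLaw s old u₀) :
    CondMeanSuppression (tiltDom s old u₀ κ ε ε₀) (fun u b => ∫ y, B y b ∂condLaw s old u) S ε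
      (2 * Real.exp (2 * ε₀) * M) :=
  condMeanSuppression_of_flat (hL := meanLipschitz_of_tilt s hm h0 hC hne hB hM) hflat

/-- **(T4) THE PAIR-MEAN LIPSCHITZ BINDER FROM THE TILT MODULUS.**  Same data, for pv28-g4's pair mean field of
commutator inserts `pairMeanField (condLaw s old u) B` (values in `Fin 2 → Fin 2 → ℂ`): the hypothesis `hL` of
`T4CoReadMoment.pairMean_norm_le_of_lipschitz` with `dev := ε`, `lip := 2e^{2ε₀}M`, `M` an oscillation bound of the
commutator insert on the fibre. [folklore] -/
theorem pairMeanField_lipschitz_of_tilt {β : Type*} (s : Finset (PBond P j)) {old : Density P j G}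
    (hm : Measurable old) (h0 : ∀ U, 0 ≤ old U) {C : ℝ} (hC : ∀ U, old U ≤ C) {u₀ : GaugeField P j G}
    (hne : fibreIntegral s old u₀ ≠ 0) {κ ε : GaugeField P j G → ℝ} {ε₀ : ℝ}
    {B : (s → G) → β → Fin 2 → Fin 2 → ℂ} {S : Finset (β × β)}
    (hB : ∀ p ∈ S, AEStronglyMeasurable (mcomm (fun y => B y p.1) (fun y => B y p.2)) (fibreBase s))
    {c : β × β → Fin 2 → Fin 2 → ℂ} {M : ℝ}
    (hM : ∀ p ∈ S, ∀ y, ‖mcomm (fun y => B y p.1) (fun y => B y p.2) y - c p‖ ≤ M) :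
    ∀ u ∈ tiltDom s old u₀ κ ε ε₀, ∀ p ∈ S,
      ‖pairMeanField (condLaw s old u) B p - pairMeanField (condLaw s old u₀) B p‖
        ≤ 2 * Real.exp (2 * ε₀) * M * ε u := by
  intro u hu p hp
  obtain ⟨hR, hε0, hε1⟩ := hu
  have hMnn : 0 ≤ M := (norm_nonneg _).trans (hM p hp (fun _ => 1))
  calc ‖pairMeanField (condLaw s old u) B p - pairMeanField (condLaw s old u₀) B p‖
        ≤ (Real.exp (2 * ε u) - 1) * M :=
          norm_integral_condLaw_sub_le s hm h0 hC hne hR (hB p hp) (hM p hp)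
    _ ≤ 2 * Real.exp (2 * ε₀) * ε u * M := mul_le_mul_of_nonneg_right (exp_two_mul_sub_one_le hε0 hε1) hMnn
    _ = 2 * Real.exp (2 * ε₀) * M * ε u := by ring

/-- (T4) … hence, with zero pair mean at the reference exterior (K9 at an axial / conjugation-invariant `u₀`:
`T4CoReadMoment.pairMeanField_vanishes_on`, `T4CoReadAxialCondLaw`; NOT touched here), the pair-mean SUPPRESSION
`‖pairMeanField (condLaw s old u) B p‖ ≤ 2e^{2ε₀}M·ε u` on the tilt domain — by `pairMean_norm_le_of_lipschitz`.
[folklore] -/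
theorem pairMeanField_norm_le_of_tilt {β : Type*} (s : Finset (PBond P j)) {old : Density P j G}
    (hm : Measurable old) (h0 : ∀ U, 0 ≤ old U) {C : ℝ} (hC : ∀ U, old U ≤ C) {u₀ : GaugeField P j G}
    (hne : fibreIntegral s old u₀ ≠ 0) {κ ε : GaugeField P j G → ℝ} {ε₀ : ℝ}
    {B : (s → G) → β → Fin 2 → Fin 2 → ℂ} {S : Finset (β × β)}
    (hB : ∀ p ∈ S, AEStronglyMeasurable (mcomm (fun y => B y p.1) (fun y => B y p.2)) (fibreBase s))
    {c : β × β → Fin 2 → Fin 2 → ℂ} {M : ℝ}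
    (hM : ∀ p ∈ S, ∀ y, ‖mcomm (fun y => B y p.1) (fun y => B y p.2) y - c p‖ ≤ M)
    (hflat : ∀ p ∈ S, pairMeanField (condLaw s old u₀) B p = 0) :
    ∀ u ∈ tiltDom s old u₀ κ ε ε₀, ∀ p ∈ S, ‖pairMeanField (condLaw s old u) B p‖ ≤ 2 * Real.exp (2 * ε₀) * M * ε u :=
  pairMean_norm_le_of_lipschitz (m₂ := fun u => pairMeanField (condLaw s old u) B) hflat
    (pairMeanField_lipschitz_of_tilt s hm h0 hC hne hB hM)

end Fibre

end Literature.MathematicalPhysics.QuantumFieldTheory.Balaban1983to89.T4TiltModulus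

end
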